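import Summits.Ventures.PercRepro.GenQPlaneSkew
import Summits.Ventures.PercRepro.GenQCovering

/-!
# PercRepro — the fundamental circuits of a basis, counted against the profile (night-4, gen 4)

For a basis `B₀` of the rank-`q` set `G` and `x ∈ G ∖ B₀`, the set `B₀ ∪ {x}` at level `d − 1` has
`m(B₀ ∪ x) = q + 1 − |C_x|` coloops and contains exactly `|C_x|` bases (`C_x = fc M x B₀`, the fundamental circuit).
Hence the pairs `(B₀, x)` with `|C_x| = c` correspond `|C_x|`-to-one to the level-`(d−1)` sets of the class
`m = q + 1 − c`: `Σ_{B₀} k_c(B₀) = c·#Pc (d−1) (q+1−c)` — the link between the TRACE rows (R1), (R2) of the type-`5`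
LP of record (sheet §55) and the profile variables.

* `mTr_insert_add_card_fc_eq`: `m(B₀ ∪ x) + |C_x| = q + 1` (`≤` is night-4 g3's; `≥`: `B₀ ∖ C_x` are coloops);
* `nb_insert_eq`: `nb(B₀ ∪ x) = |C_x|`;
* `kc`: `k_c(B₀) = #{x ∈ G ∖ B₀ : |C_x| = c}`, and `sum_kc_eq`: `Σ_{B₀ ∈ basesOf} k_c(B₀) = c·#Pc (d−1) (q+1−c)` (`3 ≤ c ≤ q + 1`).

Imports `GenQPlaneSkew` and `GenQCovering` (night-4 g3's fundamental-circuit file, through it).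
-/
namespace PercRepro.Night4

open Finset ThmH SixFour GenQ PerFlat Star

variable {α : Type*} [DecidableEq α] {M : Matroid α} [M.Finite]

/-- **`m(B₀ ∪ x) + |C_x| = q + 1`**: the coloops of `B₀ ∪ x` are exactly the basis points outside the circuit. -/
theorem mTr_insert_add_card_fc_eq {G B₀ : Finset α} {q : ℕ} (hG : G ⊆ gr M) (hrG : M.eRk (G : Set α) = (q : ℕ∞))
    (hB : B₀ ∈ basesOf M G q) {x : α} (hx : x ∈ G) (hxB : x ∉ B₀) :
    mTr M (insert x B₀) + (fc M x B₀).card = q + 1 := by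
  have hle := mTr_insert_add_card_fc_le hG hrG hB hx hxB
  have hI := indep_of_mem_basesOf hB
  have hxcl := mem_closure_of_mem_basesOf hG hrG hB hx
  obtain ⟨hBG, _, hc⟩ := mem_basesOf.1 hB
  -- `B₀ ∖ C_x ⊆ coloops(B₀ ∪ x)`
  have hsub : B₀ \ fc M x B₀ ⊆ coloopsOf M (insert x B₀) := by
    intro b hb
    rw [Finset.mem_sdiff] at hb
    rw [mem_coloopsOf]
    refine ⟨Finset.mem_insert_of_mem hb.1, fun hcl => ?_⟩
    -- `x ∈ cl(C_x ∖ x) ⊆ cl(B₀ ∖ b)`, so `cl((B₀ ∪ x) ∖ b) = cl(B₀ ∖ b) ∌ b`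
    have hxb : x ≠ b := fun h => hxB (h ▸ hb.1)
    have hC : M.IsCircuit ((fc M x B₀ : Finset α) : Set α) := isCircuit_fc hI hxcl hxB
    have hxcl' : x ∈ M.closure (((fc M x B₀).erase x : Finset α) : Set α) := by
      have := hC.mem_closure_sdiff_singleton_of_mem (Finset.mem_coe.2 (mem_fc_self x B₀))
      rwa [Finset.coe_erase]
    have hsub2 : ((fc M x B₀).erase x : Finset α) ⊆ B₀.erase b := by
      intro y hy
      rw [Finset.mem_erase] at hy ⊢
      have hyB : y ∈ insert x B₀ := fc_subset_insert x B₀ hy.2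
      rw [Finset.mem_insert] at hyB
      refine ⟨fun h => hb.2 (h ▸ hy.2), ?_⟩
      rcases hyB with h | h
      · exact absurd h hy.1
      · exact h
    have hxcl'' : x ∈ M.closure ((B₀.erase b : Finset α) : Set α) :=
      M.closure_subset_closure (Finset.coe_subset.2 hsub2) hxcl'
    have heq : ((insert x B₀).erase b : Finset α) = insert x (B₀.erase b) := by
      rw [Finset.erase_insert_of_ne hxb]
    rw [heq, Finset.coe_insert, Matroid.closure_insert_eq_of_mem_closure hxcl''] at hcl
    -- `b ∉ cl(B₀ ∖ b)`: `B₀` is independent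
    have hbnot : b ∉ M.closure ((B₀.erase b : Finset α) : Set α) := by
      have := hI.notMem_closure_sdiff_of_mem (Finset.mem_coe.2 hb.1)
      rwa [← Finset.coe_erase] at this
    exact hbnot hcl
  have h1 := Finset.card_le_card hsub
  have h2 := Finset.card_sdiff_add_card_inter B₀ (fc M x B₀)
  have h3 : B₀ ∩ fc M x B₀ = (fc M x B₀).erase x := by
    ext y
    rw [Finset.mem_inter, Finset.mem_erase]
    constructor
    · rintro ⟨hyB, hyC⟩
      exact ⟨fun h => hxB (h ▸ hyB), hyC⟩
    · rintro ⟨hyx, hyC⟩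
      exact ⟨fc_erase_subset x (Finset.mem_erase.2 ⟨hyx, hyC⟩), hyC⟩
  rw [h3, hc] at h2
  have h5 := Finset.card_erase_add_one (mem_fc_self (M := M) x B₀)
  unfold mTr at hle ⊢
  omega

/-- **`nb(B₀ ∪ x) = |C_x|`**: the bases inside `B₀ ∪ x` are the sets `(B₀ ∪ x) ∖ y`, `y ∈ C_x`. -/
theorem nb_insert_eq {G B₀ : Finset α} {q : ℕ} (hG : G ⊆ gr M) (hrG : M.eRk (G : Set α) = (q : ℕ∞))
    (hB : B₀ ∈ basesOf M G q) {x : α} (hx : x ∈ G) (hxB : x ∉ B₀) :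
    nb M G (insert x B₀) q = (fc M x B₀).card := by
  apply le_antisymm (nb_insert_le hG hrG hB hx hxB)
  have hI := indep_of_mem_basesOf hB
  have hxcl := mem_closure_of_mem_basesOf hG hrG hB hx
  obtain ⟨hBG, _, hc⟩ := mem_basesOf.1 hB
  unfold nb
  apply Finset.card_le_card_of_injOn (fun y => (insert x B₀).erase y)
  · intro y hy
    rw [Finset.mem_coe] at hy
    rw [Finset.mem_coe, Finset.mem_filter]
    have hyS : y ∈ insert x B₀ := fc_subset_insert x B₀ hy
    have hind : M.Indep (((insert x B₀).erase y : Finset α) : Set α) := by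
      have := (hI.mem_fundCircuit_iff hxcl (by exact_mod_cast hxB)).1 (mem_fc.1 hy)
      have hset : (insert x (B₀ : Set α)) \ {y} = (((insert x B₀).erase y : Finset α) : Set α) := by
        rw [Finset.coe_erase, Finset.coe_insert]
      rwa [hset] at this
    have hcard : ((insert x B₀).erase y).card = q := by
      rw [Finset.card_erase_of_mem hyS, Finset.card_insert_of_notMem hxB, hc]
      rfl
    refine ⟨mem_basesOf.2 ⟨(Finset.erase_subset _ _).trans (Finset.insert_subset hx hBG), ?_, hcard⟩,
      Finset.erase_subset _ _⟩
    rw [hind.eRk_eq_encard, Set.encard_coe_eq_coe_finsetCard, hcard]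
  · intro y hy y' hy' heq
    rw [Finset.mem_coe] at hy hy'
    have hyS : y ∈ insert x B₀ := fc_subset_insert x B₀ hy
    have hy'S : y' ∈ insert x B₀ := fc_subset_insert x B₀ hy'
    simp only at heq
    by_contra hne
    have : y' ∈ (insert x B₀).erase y := Finset.mem_erase.2 ⟨Ne.symm hne, hy'S⟩
    rw [heq] at this
    exact (Finset.mem_erase.1 this).1 rfl

/-- `k_c(B₀) = #{x ∈ G ∖ B₀ : |C_x| = c}`. -/
noncomputable def kc (M : Matroid α) [M.Finite] (G B₀ : Finset α) (c : ℕ) : ℕ :=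
  ((G \ B₀).filter (fun x => (fc M x B₀).card = c)).card

/-- **`Σ_{B₀} k_c(B₀) = c·#Pc (d−1) (q+1−c)`**: the pairs `(B₀, x)` with `|C_x| = c` map `|C_x|`-to-one onto the
level-`(d−1)` sets with `q + 1 − c` coloops (`B₀ ∪ x`; the bases of such a set are its `nb = c` bases). -/
theorem sum_kc_eq {G : Finset α} {q d c : ℕ} (hG : G ⊆ gr M) (hrG : M.eRk (G : Set α) = (q : ℕ∞))
    (hcard : G.card = q + d) (hd : 1 ≤ d) (hc : c ≤ q + 1) :
    ∑ B₀ ∈ basesOf M G q, kc M G B₀ c = c * (Pc M G q (d - 1) (q + 1 - c)).card := by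
  -- both sides count the pairs `(S, B₀)` with `S ∈ Pc (d−1) (q+1−c)`, `B₀ ⊆ S` a basis
  have hR : ∑ B₀ ∈ basesOf M G q, kc M G B₀ c =
      ((basesOf M G q).sigma (fun B₀ => (G \ B₀).filter (fun x => (fc M x B₀).card = c))).card := by
    rw [Finset.card_sigma]; rfl
  have hL : c * (Pc M G q (d - 1) (q + 1 - c)).card =
      ((Pc M G q (d - 1) (q + 1 - c)).sigma (fun S => (basesOf M G q).filter (fun B₀ => B₀ ⊆ S))).card := by
    rw [Finset.card_sigma, Finset.card_eq_sum_ones (Pc M G q (d - 1) (q + 1 - c)), Finset.mul_sum]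
    apply Finset.sum_congr rfl
    intro S hS
    rw [mul_one]
    -- `S = B₀ ∪ x` for any basis `B₀ ⊆ S`: `nb S = |C_x| = c`
    have hS' := mem_Pc.1 hS
    obtain ⟨B₀, hB₀⟩ := Finset.card_pos.1 (one_le_nb hS'.1)
    rw [Finset.mem_filter] at hB₀
    have hB := mem_basesOf.1 hB₀.1
    have hSG := (mem_Rq.1 hS'.1).1
    have hSc : S.card = q + 1 := by
      have h1 : (G \ S).card + S.card = G.card := by
        rw [Finset.card_sdiff_of_subset hSG]
        exact Nat.sub_add_cancel (Finset.card_le_card hSG)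
      rw [hS'.2.1, hcard] at h1
      omega
    obtain ⟨x, hxS, hxB⟩ := Finset.exists_mem_notMem_of_card_lt_card (show B₀.card < S.card by rw [hB.2.2, hSc]; omega)
    have hSeq : S = insert x B₀ := by
      symm
      apply Finset.eq_of_subset_of_card_le (Finset.insert_subset hxS hB₀.2)
      rw [Finset.card_insert_of_notMem hxB, hB.2.2, hSc]
    have hm := mTr_insert_add_card_fc_eq hG hrG hB₀.1 (hSG hxS) hxB
    rw [← hSeq, hS'.2.2] at hm
    have hfc : (fc M x B₀).card = c := by omega
    have hnb := nb_insert_eq hG hrG hB₀.1 (hSG hxS) hxB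
    rw [← hSeq, hfc] at hnb
    exact hnb.symm
  rw [hR, hL]
  -- `(B₀, x) ↦ (B₀ ∪ x, B₀)`: injective, and onto the pairs `(S, B₀)`
  apply le_antisymm
  · apply Finset.card_le_card_of_injOn (fun p => ⟨insert p.2 p.1, p.1⟩)
    · rintro ⟨B₀, x⟩ hp
      rw [Finset.mem_coe, Finset.mem_sigma, Finset.mem_filter, Finset.mem_sdiff] at hp
      simp only at hp ⊢
      obtain ⟨hB₀, ⟨hxG, hxB⟩, hfc⟩ := hp
      have hB := mem_basesOf.1 hB₀
      rw [Finset.mem_coe, Finset.mem_sigma, Finset.mem_filter]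
      refine ⟨mem_Pc.2 ⟨insert_mem_Rq hrG hB₀ hxG, ?_, ?_⟩, hB₀, Finset.subset_insert x B₀⟩
      · show (G \ insert x B₀).card = d - 1
        rw [Finset.sdiff_insert, Finset.card_erase_of_mem (Finset.mem_sdiff.2 ⟨hxG, hxB⟩),
          Finset.card_sdiff_of_subset hB.1, hcard, hB.2.2]
        omega
      · show mTr M (insert x B₀) = q + 1 - c
        have := mTr_insert_add_card_fc_eq hG hrG hB₀ hxG hxB
        rw [hfc] at this
        omega
    · rintro ⟨B₀, x⟩ hp ⟨B₀', x'⟩ hp' heq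
      rw [Finset.mem_coe, Finset.mem_sigma, Finset.mem_filter, Finset.mem_sdiff] at hp hp'
      simp only at hp hp'
      simp only [Sigma.mk.injEq] at heq
      obtain ⟨hS, hB⟩ := heq
      have hB' : B₀ = B₀' := eq_of_heq hB
      subst hB'
      have hx : x ∈ insert x' B₀ := hS ▸ Finset.mem_insert_self x B₀
      rw [Finset.mem_insert] at hx
      rcases hx with h | h
      · rw [h]
      · exact absurd h hp.2.1.2
  · apply Finset.card_le_card_of_surjOn (fun p => ⟨insert p.2 p.1, p.1⟩)
    rintro ⟨S, B₀⟩ hp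
    rw [Finset.mem_coe, Finset.mem_sigma, Finset.mem_filter] at hp
    simp only at hp
    obtain ⟨hS, hB₀, hBS⟩ := hp
    have hS' := mem_Pc.1 hS
    have hB := mem_basesOf.1 hB₀
    have hSG := (mem_Rq.1 hS'.1).1
    have hSc : S.card = q + 1 := by
      have h1 : (G \ S).card + S.card = G.card := by
        rw [Finset.card_sdiff_of_subset hSG]
        exact Nat.sub_add_cancel (Finset.card_le_card hSG)
      rw [hS'.2.1, hcard] at h1
      omega
    obtain ⟨x, hxS, hxB⟩ := Finset.exists_mem_notMem_of_card_lt_card (show B₀.card < S.card by rw [hB.2.2, hSc]; omega)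
    have hSeq : S = insert x B₀ := by
      symm
      apply Finset.eq_of_subset_of_card_le (Finset.insert_subset hxS hBS)
      rw [Finset.card_insert_of_notMem hxB, hB.2.2, hSc]
    refine ⟨⟨B₀, x⟩, ?_, ?_⟩
    · rw [Finset.mem_coe, Finset.mem_sigma, Finset.mem_filter, Finset.mem_sdiff]
      refine ⟨hB₀, ⟨hSG hxS, hxB⟩, ?_⟩
      show (fc M x B₀).card = c
      have := mTr_insert_add_card_fc_eq hG hrG hB₀ (hSG hxS) hxB
      rw [← hSeq, hS'.2.2] at this
      omega
    · simp only
      rw [← hSeq]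

end PercRepro.Night4

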